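import Summits.BirchSwinnertonDyer.BirchSwinnertonDyer.Theorems.EisensteinDepletionAtTwoStarStabCoeff
import Summits.BirchSwinnertonDyer.BirchSwinnertonDyer.Theorems.EisensteinDepletionAtTwoStarKummerDefs
import HarnessLib

/-!
# Route `EisensteinDepletionAtTwo`, crux `StarGO2Sigma` (stmt-BirchSwinnertonDyer-27046), line `kummer` v7 —
# Kr `stub_expVecParity`: the exponent `r_t = N·c_t` is ODD exactly on `T(N) = kummerThetaDivisors N`

planner bsd-rank2-p2 GEN 38, PART 13 (evidence for 27046; the lead lands it `--supports 27046`).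

THE CLAIM (Kr of HOME/p2/g38/KUMMER-V7-DESIGN.md): for `N` odd and `β` admissible, an integer vector `r` with `r_t = N c_t`
(`c_t = stabCoeff N β t`) on `t ∣ N` satisfies `Odd (r t) ↔ t ∈ kummerThetaDivisors N` for every `t ∣ N` — independently of `β`.

PROOF: `N c_t = ∏_{ℓ ∣ N} ℓ^{v_ℓ N}·L_ℓ(v_ℓ t)` and each factor is an INTEGER `m_ℓ(j)` (`localInt`): at `ℓ ∥ N` it is `ℓ` or
`−β_ℓ ∈ {−1, −ℓ}` (odd); at `ℓ² ∥ N` it is `ℓ²`, `−ℓ(ℓ+1)` (EVEN), `ℓ` for `j = 0, 1, 2`.  A product of integers is odd iff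
every factor is.  Pure arithmetic of the tree's `stabCoeff` / `localStabCoeff`; no elliptic curve, no analysis; sorry-free.
[cite: Stevens1982, §2.4 (PDF pp. 35–37)]
-/

set_option autoImplicit false
set_option linter.dupNamespace false

namespace Summit.BirchSwinnertonDyer.BirchSwinnertonDyer.Theorems.DepletionAtTwo.KEta.ExpVecParity

variable {N : ℕ} {β : ℕ → ℕ}

/-! ## §1 The integer local factors `m_ℓ(j) = ℓ^{v_ℓ N}·L_ℓ(j)` -/

/-- The integer local factor `m_ℓ(j) := ℓ^{v_ℓ(N)} · c_ℓ(j)` (meaningful for `v_ℓ(N) ∈ {1, 2}`).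
[cite: Stevens1982, §2.4 (PDF pp. 35–37)] -/
def localInt (N : ℕ) (β : ℕ → ℕ) (ℓ j : ℕ) : ℤ :=
  if N.factorization ℓ = 1 then (if j = 0 then (ℓ : ℤ) else if j = 1 then -(β ℓ : ℤ) else 0)
  else if N.factorization ℓ = 2 then
    (if j = 0 then (ℓ : ℤ) ^ 2 else if j = 1 then -((ℓ : ℤ) * (ℓ + 1)) else if j = 2 then (ℓ : ℤ) else 0)
  else (if j = 0 then 1 else 0)

/-- `m_ℓ(j) = ℓ^{v_ℓ N} · c_ℓ(j)` in `ℚ` when `v_ℓ(N) ∈ {1, 2}`. [cite: Stevens1982, §2.4 (PDF pp. 35–37)] -/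
theorem localInt_cast {ℓ : ℕ} (hℓ : ℓ ≠ 0) (he : N.factorization ℓ = 1 ∨ N.factorization ℓ = 2) (j : ℕ) :
    (localInt N β ℓ j : ℚ) = (ℓ : ℚ) ^ N.factorization ℓ * localStabCoeff N β ℓ j := by
  have hℓ' : (ℓ : ℚ) ≠ 0 := by exact_mod_cast hℓ
  unfold localInt localStabCoeff
  rcases he with h | h
  · simp only [h, if_true, pow_one]
    by_cases hj0 : j = 0
    · simp [hj0]
    · by_cases hj1 : j = 1
      · simp only [hj1, if_true]
        push_cast
        field_simp
      · simp [hj0, hj1]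
  · simp only [h, show (2 : ℕ) ≠ 1 from by decide, if_false, if_true]
    by_cases hj0 : j = 0
    · simp [hj0]
    · by_cases hj1 : j = 1
      · simp only [hj1, if_true]
        push_cast
        field_simp
        ring
      · by_cases hj2 : j = 2
        · simp only [hj2, if_true]
          push_cast
          field_simp
        · simp [hj0, hj1, hj2]

/-- `N = ∏_{ℓ ∣ N} ℓ^{v_ℓ N}` in `ℚ`. [folklore] -/
theorem natCast_eq_prod_pow (hN : N ≠ 0) : (N : ℚ) = ∏ ℓ ∈ N.primeFactors, (ℓ : ℚ) ^ N.factorization ℓ := by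
  have h := Nat.prod_factorization_pow_eq_self hN
  rw [Finsupp.prod, Nat.support_factorization] at h
  conv_lhs => rw [← h]
  push_cast
  rfl

/-- **`N c_t = ∏_ℓ m_ℓ(v_ℓ t)`** for admissible data. [cite: Stevens1982, §2.4 (PDF pp. 35–37)] -/
theorem natCast_mul_stabCoeff_eq_prod (hN : N ≠ 0) (hadm : IsAdmissibleStabData N β) (t : ℕ) :
    (N : ℚ) * stabCoeff N β t = ((∏ ℓ ∈ N.primeFactors, localInt N β ℓ (t.factorization ℓ) : ℤ) : ℚ) := by
  rw [natCast_eq_prod_pow hN, stabCoeff, ← Finset.prod_mul_distrib, Int.cast_prod]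
  refine Finset.prod_congr rfl fun ℓ hℓ ↦ ?_
  rw [localInt_cast (Nat.prime_of_mem_primeFactors hℓ).ne_zero (factorization_eq_one_or_two_of_admissible hadm hℓ)]

/-- `r_t = ∏_ℓ m_ℓ(v_ℓ t)` as integers. [cite: Stevens1982, §2.4 (PDF pp. 35–37)] -/
theorem expVec_eq_prod (hN : N ≠ 0) (hadm : IsAdmissibleStabData N β) {r : ℕ → ℤ} {t : ℕ}
    (hr : (r t : ℚ) = N * stabCoeff N β t) : r t = ∏ ℓ ∈ N.primeFactors, localInt N β ℓ (t.factorization ℓ) := by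
  rw [natCast_mul_stabCoeff_eq_prod hN hadm] at hr
  exact_mod_cast hr

/-! ## §2 Parities -/

/-- A finite product of integers is odd iff every factor is. [folklore] -/
theorem odd_prod_iff {ι : Type*} [DecidableEq ι] (s : Finset ι) (f : ι → ℤ) :
    Odd (∏ i ∈ s, f i) ↔ ∀ i ∈ s, Odd (f i) := by
  induction s using Finset.induction_on with
  | empty => simp
  | insert a s ha ih => rw [Finset.prod_insert ha, Int.odd_mul, ih, Finset.forall_mem_insert]

/-- **Parity of the local factor**: for `N` odd, `β` admissible, `ℓ ∣ N` prime and `j ≤ v_ℓ(N)`, `m_ℓ(j)` is odd unless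
`v_ℓ(N) = 2` and `j = 1` (`m_ℓ(1) = −ℓ(ℓ+1)`). [cite: Stevens1982, §2.4 (PDF pp. 35–37)] -/
theorem odd_localInt_iff (hodd : Odd N) (hadm : IsAdmissibleStabData N β) {ℓ : ℕ} (hℓ : ℓ ∈ N.primeFactors) {j : ℕ}
    (hj : j ≤ N.factorization ℓ) : Odd (localInt N β ℓ j) ↔ (2 ≤ N.factorization ℓ → j ≠ 1) := by
  have hℓodd : Odd ℓ := hodd.of_dvd_nat (Nat.dvd_of_mem_primeFactors hℓ)
  have hℓz : Odd (ℓ : ℤ) := hℓodd.natCast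
  unfold localInt
  rcases factorization_eq_one_or_two_of_admissible hadm hℓ with h | h
  · -- `ℓ ∥ N`: every factor odd, conclusion vacuous
    simp only [h, if_true, show ¬ (2 ≤ 1) from by omega, false_implies, iff_true]
    rw [h] at hj
    by_cases hj0 : j = 0
    · simp only [hj0, if_true]; exact hℓz
    · have hj1 : j = 1 := by omega
      simp only [hj1, if_false, if_true, one_ne_zero]
      rcases hadm.2.1 ℓ hℓ h with hb | hb
      · rw [hb]; exact ⟨-1, by norm_num⟩
      · rw [hb]; exact hℓz.neg
  · simp only [h, show (2 : ℕ) ≠ 1 from by decide, if_false, if_true, le_refl, true_implies]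
    rw [h] at hj
    by_cases hj0 : j = 0
    · simp only [hj0, if_true, zero_ne_one, ne_eq, not_false_eq_true, iff_true]
      exact hℓz.pow
    · by_cases hj1 : j = 1
      · simp only [hj1, if_true, ne_eq, not_true_eq_false, iff_false, Int.not_odd_iff_even]
        exact (hℓz.add_one.mul_left _).neg
      · have hj2 : j = 2 := by omega
        simp only [hj2, if_false, if_true, ne_eq, show (2 : ℕ) ≠ 1 from by decide, not_false_eq_true, iff_true]
        exact hℓz

/-! ## §3 Kr -/

/-- **Kr `stub_expVecParity`**: for `N` odd, `β` admissible and `r_t = N c_t` on `t ∣ N`: `r_t` is odd iff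
`t ∈ kummerThetaDivisors N` (`v_ℓ(t) ≠ 1` at every `ℓ² ∥ N`).  Literally the v7 stub with `IsExpVec` unfolded.
[cite: Stevens1982, §2.4 (PDF pp. 35–37)] -/
theorem expVecParity (N : ℕ) (β : ℕ → ℕ) (r : ℕ → ℤ) (hodd : Odd N) (hadm : IsAdmissibleStabData N β)
    (hr : ∀ t ∈ N.divisors, (r t : ℚ) = N * stabCoeff N β t) :
    ∀ t ∈ N.divisors, Odd (r t) ↔ t ∈ kummerThetaDivisors N := by
  intro t ht
  have hN : N ≠ 0 := fun h ↦ by simp [h] at hodd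
  have ht0 : t ≠ 0 := (Nat.pos_of_mem_divisors ht).ne'
  have hle : t.factorization ≤ N.factorization := (Nat.factorization_le_iff_dvd ht0 hN).mpr (Nat.dvd_of_mem_divisors ht)
  rw [expVec_eq_prod hN hadm (hr t ht), odd_prod_iff, mem_kummerThetaDivisors, and_iff_right ht]
  refine forall₂_congr fun ℓ hℓ ↦ ?_
  exact odd_localInt_iff hodd hadm hℓ (hle ℓ)

end Summit.BirchSwinnertonDyer.BirchSwinnertonDyer.Theorems.DepletionAtTwo.KEta.ExpVecParity
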